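/-
COR-CM (cell pub-hodgecm2, stage 2 of the Hodge ladder) — count-neutral KERNEL SCHEMA «INT-2 for a generating set of faces AND
products with KNOWN Hodge conjecture» (seat prover-pub-hodgecm2-b09-g21-0, binder prover b09, gen 21; own lane
DECIC-MARKMAN-TRANSPORT, HOME/lit/LIT-STATUS.md 2026-08-21T18:29:36Z, HOME/INBOX.md l.4703/l.4704; sequel of seat b23's
`CorCM/FacePeriodsGeneratingSet.lean`, consumed BY NAME).  Theorems only; no definition, no named fact, nothing asserted; NOT an
E term, no BINDER-OWNERS row; `Interfaces.lean` (C1), `Assembly/ModelChain*`, `B01/*`, `Transposition/*`, `StubTree/*` untouched.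
HONEST FRAMING (COORDINATOR RULING — HODGE FRAMING CORRECTION, 2026-08-21T11:55:35Z): `HC_CM` is NOT proved, here or anywhere in
the tree.  This file proves NO face period and NO case of the Hodge conjecture; it records that in the face transport the
generating set may be ENLARGED by the Lefschetz characters of the Hodge weights of products whose Hodge conjecture is KNOWN from
another source (e.g. Markman's theorems), so that fewer face periods are needed for the `F`-generated CM slice.
T5 (coordinator ruling 15:33:56Z (3)): §1/§2 binders = [QW8] step Props, `PohlmannSpan`, the inline «known products» hypothesis,
`ModelAxioms` + N1–N4, F2, F4–F7 — ALL INHABITED on the universe of record by the tree theorems §3/§4 feed, exactly as in b23's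
file; the CLOSED §4 keeps only Weil-line algebraicity / period witnesses on `𝒮` and `HodgeConjectureFor` on the products of `𝒲`,
both instances of the Hodge conjecture (no `¬` theorem in the tree); no contradiction derivable; checker: self, 2026-08-21.
-/
import Summits.HodgeConjecture.CorCM.FacePeriodsGeneratingSet
import Summits.HodgeConjecture.CorCM.Proofs.Pohlmann.PohlmannEq
import Summits.HodgeConjecture.CorCM.Proofs.Pohlmann.WeightLinesMonomial
import HarnessLib

/-!
# Face periods of a generating set of faces PLUS products with known Hodge conjecture ⟹ the `F`-generated CM slice

Seat b23's schema INT2-GEN (`CorCM/FacePeriodsGeneratingSet.lean`): for ONE Galois CM field `F` with `6 ≤ [F:ℚ]`, if the Weil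
characters `lefChar g.corner (· ↦ {σ})` of a SET `𝒮` of faces generate (in `Asym F`) the `σ₀`-Weil characters of ALL faces of
`F`, then algebraicity of the face lines `W_F(P(g))`, `g ∈ 𝒮`, gives `U.HC (∏_j A_{(F,Θ_j)})` for every family `Θ`.  Its engine
([QW8] Thm 2.5, `Universe.algC_of_isWeightVector_of_faceSet`) only uses that the characters of the faces of `𝒮` lie in the set
`A ⊆ Asym F` of Lefschetz characters CARRIED BY NONZERO ALGEBRAIC WEIGHT VECTORS, stable under `−` and `+` (steps (i), (ii)).

This file adds a second kind of generator to the same engine: a set `𝒲` of finite families `Θ′` of CM types of `F` for which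
`U.HC (∏_j A_{(F,Θ′_j)})` is KNOWN.  By Pohlmann's theorem in print form (`Universe.PohlmannBasis`, `pohlmannBasis_of_facts`,
`Proofs/Pohlmann/PohlmannEq.lean`) the weight space `V_{S′}` of every HODGE weight `S′` on such a product lies in
`B^{p′} ⊗ ℂ ⊆ Alg^{p′} ⊗ ℂ`, and it is a LINE in positive degree (`Universe.finrank_weightSpace_succ`,
`Proofs/Pohlmann/WeightLinesMonomial.lean`); hence `lefChar Θ′ S′ ∈ A` (§2 `Universe.exists_weightVector_mem_algC_of_hc`), and
(§1 `Universe.algC_of_isWeightVector_of_faceSet_of_known`, `Universe.hc_cmProd_of_faceSet_of_known`):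

  if the `σ₀`-Weil character of EVERY face of `F` lies in the subgroup of `Asym F` generated by the Weil characters of the faces
  of `𝒮` (all `σ`) AND the characters `lefChar Θ′ S′` of the Hodge weights `S′` on the families `Θ′ ∈ 𝒲`, then algebraicity of
  `W_F(P(g))` for `g ∈ 𝒮` and `U.HC (∏_j A_{(F,Θ′_j)})` for `Θ′ ∈ 𝒲` imply `U.HC (∏_j A_{(F,Θ_j)})` for every `Θ`.

With `𝒲 = ∅` the binder is b23's `hgen(𝒮, σ₀)` (`AddSubgroup.closure_mono`), so nothing is lost.  §2 spells the facts out (pattern of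
`Assembly.hc_cmProd_of_faceSet`); §3 reads it on the model universe modulo Riemann's theorem `hR`, the known products being fed
as `HodgeConjectureFor` statements about the tree's abelian varieties `Domination.cmProdAV F h₃ m Θ′`
(`Model.universeOf_hc_cmProd_iff_hodgeConjectureFor_cmProdAV`);
§4 gives the CLOSED forms on the universe of record (headline
`hodgeConjectureFor_of_avDominatedBy_isProductOf_of_exists_facePeriod_of_hodgeConjectureFor_on`).  USE: the «Markman column» of
the degree-by-degree census (degree 10, cyclic type: TWO generating faces + `A_{Θ_ind} × A_{Φ₀}`, filed separately).

References: [QW8] Thm 2.5 (kernel: `StubTree/Qw8*.lean`); Pohlmann 1968 Thm. 1 in the print form of Gao–Ullmo 2025 Thm 3.1;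
Milne, Duke 96 (1999) Thm. 3.2 / Cor. 4.5; Shimura 1998 §6.1–6.2; Mumford §19; Deligne–Milne LNM 900 Thm. 6.20.
-/

noncomputable section

open CategoryTheory NumberField Literature.AlgebraicGeometry Literature.AlgebraicGeometry.Motives
open Literature.AlgebraicGeometry.HodgeTheory Literature.AlgebraicGeometry.ComplexMultiplication Literature.AlgebraicGeometry.Milne1999
open Literature.NumberTheory.Automorphic Literature.NumberTheory.Automorphic.PicardCM

namespace Summit.HodgeConjecture.CorCM

/-! ## §1 Abstract universe: [QW8] Thm 2.5 with known products as extra generators -/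

namespace Universe

variable {U : Universe}
/-- **[QW8] Thm 2.5 for a SET of faces and a SET of products with algebraic Hodge weight vectors.**  `F` Galois CM with
`6 ≤ [F:ℚ]`, `𝒮` a set of faces whose Weil lines are algebraic, `𝒲` a set of finite families `Θ′` of CM types of `F` on whose
products every Hodge weight of positive degree is carried by a NONZERO ALGEBRAIC weight vector (`hknown`; on the model: `U.HC`, §2).
A weight vector `x` on `∏_j A_{(F,Θ_j)}` whose Lefschetz character lies in the subgroup of `Asym F` generated by the Weil characters
`lefChar g.corner (· ↦ {σ})` (`g ∈ 𝒮`) and the characters `lefChar Θ′ S′` (`Θ′ ∈ 𝒲`, `S′` a Hodge weight) is a complexified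
algebraic class (the argument of `Universe.algC_of_isWeightVector_of_faceSet`; the subgroup of characters of nonzero algebraic
weight vectors, with `0` adjoined, contains both kinds of generators). [cite: Milne1999LefschetzClasses, Thm. 3.2 and Cor. 4.5]
[cite: Pohlmann1968, Thm. 1] -/
theorem algC_of_isWeightVector_of_faceSet_of_known (hC : U.Qw8Conj) (hE : U.Qw8ExtProd) (hD : U.Qw8DualPushPull)
    (hM : U.Qw8Milne) (hB : U.Qw8FaceBridge) {F : CMField} (hGal : IsGalois ℚ F) (h6 : 6 ≤ Module.finrank ℚ F)
    {𝒮 : Set (Face F)} (hWeil : ∀ f ∈ 𝒮, U.WeilFaceAlgebraic F f)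
    {𝒲 : Set ((m : ℕ) × (Fin (m + 1) → CMType F))}
    (hknown : ∀ w ∈ 𝒲, ∀ (p' : ℕ) (S' : Fin (w.1 + 1) → Finset ((F : Type) →+* ℂ)), 0 < p' →
      IsHodgeWeight w.2 p' S' → ∃ x' : U.CohC (U.cmProd F w.2) (2 * p'),
        x' ≠ 0 ∧ U.IsWeightVector F w.2 S' (2 * p') x' ∧ x' ∈ U.algC (U.cmProd F w.2) p')
    {n : ℕ} {Θ : Fin (n + 1) → CMType F} {p : ℕ}
    {S : Fin (n + 1) → Finset ((F : Type) →+* ℂ)} {x : U.CohC (U.cmProd F Θ) (2 * p)}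
    (hx : U.IsWeightVector F Θ S (2 * p) x)
    (hchar : lefChar Θ S ∈ AddSubgroup.closure
      {a : Asym F | (∃ g ∈ 𝒮, ∃ σ : (F : Type) →+* ℂ,
          a = lefChar g.corner (fun _ => ({σ} : Finset ((F : Type) →+* ℂ)))) ∨
        ∃ w ∈ 𝒲, ∃ (p' : ℕ) (S' : Fin (w.1 + 1) → Finset ((F : Type) →+* ℂ)),
          IsHodgeWeight w.2 p' S' ∧ a = lefChar w.2 S'}) :
    x ∈ U.algC (U.cmProd F Θ) p := by
  by_cases hx0 : x = 0
  · rw [hx0]; exact Submodule.zero_mem _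
  let e : U.WVec F := ⟨n, Θ, p, S, x, hx0, hx⟩
  change e.IsAlg
  have he : e.achar = lefChar Θ S := rfl
  by_cases ha : e.achar = 0
  · exact hM F hGal h6 e ha
  -- the set of characters carried by nonzero algebraic weight vectors, with `0` adjoined
  let A : Set (Asym F) := {a | a = 0 ∨ ∃ z : U.WVec F, z.IsAlg ∧ z.achar = a}
  have hAneg : ∀ a ∈ A, -a ∈ A := by
    rintro a (rfl | ⟨z, hz, rfl⟩)
    · exact Or.inl neg_zero
    · obtain ⟨z', hz', h'⟩ := hC F z hz
      exact Or.inr ⟨z', hz', h'⟩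
  have hAadd : ∀ a ∈ A, ∀ b ∈ A, a + b ∈ A := by
    rintro a (rfl | ⟨z, hz, rfl⟩) b hb
    · rwa [zero_add]
    · rcases hb with rfl | ⟨w, hw, rfl⟩
      · rw [add_zero]; exact Or.inr ⟨z, hz, rfl⟩
      · obtain ⟨y, hy, h'⟩ := hE F hGal h6 z w hz hw
        exact Or.inr ⟨y, hy, h'⟩
  let G : AddSubgroup (Asym F) :=
    { carrier := A
      zero_mem' := Or.inl rfl
      add_mem' := fun ha hb => hAadd _ ha _ hb
      neg_mem' := fun ha => hAneg _ ha }
  -- both kinds of generators lie in `G`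
  have hle : AddSubgroup.closure
      {a : Asym F | (∃ g ∈ 𝒮, ∃ σ : (F : Type) →+* ℂ,
          a = lefChar g.corner (fun _ => ({σ} : Finset ((F : Type) →+* ℂ)))) ∨
        ∃ w ∈ 𝒲, ∃ (p' : ℕ) (S' : Fin (w.1 + 1) → Finset ((F : Type) →+* ℂ)),
          IsHodgeWeight w.2 p' S' ∧ a = lefChar w.2 S'} ≤ G := by
    rw [AddSubgroup.closure_le]
    rintro a (⟨g, hg, σ, rfl⟩ | ⟨w, hw, p', S', hS', rfl⟩)
    · -- the ā-bridge, at the face `g ∈ 𝒮`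
      obtain ⟨y, hy0, hyw, hya⟩ := hB F hGal h6 g (hWeil g hg) σ
      exact Or.inr ⟨⟨3, g.corner, 2, fun _ => {σ}, y, hy0, hyw⟩, hya, rfl⟩
    · rcases Nat.eq_zero_or_pos p' with rfl | hp'
      · -- degree `0`: every `S′ j` is empty and the character vanishes
        have hS0 : ∀ j, S' j = ∅ := by
          have h := hS'.1
          rw [mul_zero, Finset.sum_eq_zero_iff] at h
          exact fun j => Finset.card_eq_zero.mp (h j (Finset.mem_univ j))
        refine Or.inl ?_
        simp only [lefChar, hS0, Finset.sum_empty, Finset.sum_const_zero]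
      · obtain ⟨x', hx'0, hx'w, hx'a⟩ := hknown w hw p' S' hp' hS'
        exact Or.inr ⟨⟨w.1, w.2, p', S', x', hx'0, hx'w⟩, hx'a, rfl⟩
  have heA : e.achar ∈ G := by
    rw [he]
    exact hle hchar
  rcases heA with h0 | ⟨W, hW, hWa⟩
  · exact absurd h0 ha
  obtain ⟨Z, hZa, hZ⟩ := hD F hGal h6 e W hW
  exact hZ (hM F hGal h6 Z (by rw [hZa, hWa, sub_self]))

/-- **FACE REDUCTION FOR A GENERATING SET OF FACES AND KNOWN PRODUCTS (abstract).**  With Pohlmann's span theorem in addition: if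
the `σ₀`-Weil character of EVERY face of `F` lies in the subgroup generated by the Weil characters of the faces of `𝒮` and the
Hodge-weight characters of the families of `𝒲` (`hknown` as above), then algebraicity of `W_F(P(f))` for `f ∈ 𝒮` implies
`U.HC (∏_j A_{(F,Θ_j)})` for every finite family `Θ` of CM types of `F`. [cite: Pohlmann1968, Thm. 1]
[cite: Milne1999LefschetzClasses, Thm. 3.2 and Cor. 4.5] [cite: Andre1992HodgeCM, Théorème (pp. 4–5)] -/
theorem hc_cmProd_of_faceSet_of_known (hP : U.PohlmannSpan) (hC : U.Qw8Conj) (hE : U.Qw8ExtProd) (hD : U.Qw8DualPushPull)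
    (hM : U.Qw8Milne) (hB : U.Qw8FaceBridge) {F : CMField} (hGal : IsGalois ℚ F) (h6 : 6 ≤ Module.finrank ℚ F)
    (𝒮 : Set (Face F)) (𝒲 : Set ((m : ℕ) × (Fin (m + 1) → CMType F)))
    (hknown : ∀ w ∈ 𝒲, ∀ (p' : ℕ) (S' : Fin (w.1 + 1) → Finset ((F : Type) →+* ℂ)), 0 < p' →
      IsHodgeWeight w.2 p' S' → ∃ x' : U.CohC (U.cmProd F w.2) (2 * p'),
        x' ≠ 0 ∧ U.IsWeightVector F w.2 S' (2 * p') x' ∧ x' ∈ U.algC (U.cmProd F w.2) p')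
    (σ₀ : (F : Type) →+* ℂ)
    (hgen : ∀ f : Face F, lefChar f.corner (fun _ => ({σ₀} : Finset ((F : Type) →+* ℂ))) ∈ AddSubgroup.closure
      {a : Asym F | (∃ g ∈ 𝒮, ∃ σ : (F : Type) →+* ℂ,
          a = lefChar g.corner (fun _ => ({σ} : Finset ((F : Type) →+* ℂ)))) ∨
        ∃ w ∈ 𝒲, ∃ (p' : ℕ) (S' : Fin (w.1 + 1) → Finset ((F : Type) →+* ℂ)),
          IsHodgeWeight w.2 p' S' ∧ a = lefChar w.2 S'})
    (hWeil : ∀ f ∈ 𝒮, U.WeilFaceAlgebraic F f) {n : ℕ} (Θ : Fin (n + 1) → CMType F) : U.HC (U.cmProd F Θ) := by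
  intro p c hc
  haveI := hGal
  have h1 : (HodgeStructure.ofRat c : U.CohC (U.cmProd F Θ) (2 * p)) ∈
      Submodule.span ℂ {x : U.CohC (U.cmProd F Θ) (2 * p) |
        ∃ S : Fin (n + 1) → Finset ((F : Type) →+* ℂ),
          IsHodgeWeight Θ p S ∧ U.IsWeightVector F Θ S (2 * p) x} :=
    hP F hGal h6 n Θ p (Submodule.mem_map_of_mem hc)
  have h2 : Submodule.span ℂ {x : U.CohC (U.cmProd F Θ) (2 * p) |
        ∃ S : Fin (n + 1) → Finset ((F : Type) →+* ℂ),
          IsHodgeWeight Θ p S ∧ U.IsWeightVector F Θ S (2 * p) x} ≤ U.algC (U.cmProd F Θ) p := by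
    rw [Submodule.span_le]
    rintro x ⟨S, hS, hx⟩
    obtain ⟨m, f, cf, hsum⟩ := lefChar_eq_sum_faces Θ S hS σ₀
    refine algC_of_isWeightVector_of_faceSet_of_known hC hE hD hM hB hGal h6 hWeil hknown hx ?_
    rw [hsum]
    exact AddSubgroup.sum_mem _ (fun i _ => AddSubgroup.zsmul_mem _ (hgen (f i)) (cf i))
  exact U.mem_alg_of_ofRat_mem_algC (h2 h1)

/-! ## §2 The known-products hypothesis from `U.HC` (Pohlmann's theorem `⊇` + weight lines), and the facts spelled out -/

/-- **On a product with KNOWN Hodge conjecture, every Hodge weight of positive degree is carried by a nonzero ALGEBRAIC weight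
vector** (`ModelAxioms` + N1–N4: `V_{S′}` is a line, `finrank_weightSpace_succ`; `V_{S′} ⊆ B^{p′} ⊗ ℂ`, `pohlmannBasis_of_facts`;
`B^{p′} ⊆ Alg^{p′}` is `U.HC`). [cite: Pohlmann1968, Thm. 1] [cite: GaoUllmo2025, Thm. 3.1] -/
theorem exists_weightVector_mem_algC_of_hc (M : U.ModelAxioms) (hN1 : U.Fact_cupExterior) (hN2 : U.Fact_cup_hodge)
    (hN3 : U.Fact_pull_H0) (hN4 : U.Fact_hodge_F0) {F : CMField} (hGal : IsGalois ℚ F) {m : ℕ}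
    {Θ' : Fin (m + 1) → CMType F} (hHC : U.HC (U.cmProd F Θ')) {p' : ℕ} (hp' : 0 < p')
    {S' : Fin (m + 1) → Finset ((F : Type) →+* ℂ)} (hS' : IsHodgeWeight Θ' p' S') :
    ∃ x' : U.CohC (U.cmProd F Θ') (2 * p'), x' ≠ 0 ∧ U.IsWeightVector F Θ' S' (2 * p') x' ∧
      x' ∈ U.algC (U.cmProd F Θ') p' := by
  obtain ⟨k, hk⟩ : ∃ k : ℕ, k + 1 = 2 * p' := ⟨2 * p' - 1, by omega⟩
  have hfin : Module.finrank ℂ (U.weightSpace F Θ' S' (k + 1)) = 1 := by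
    rw [finrank_weightSpace_succ M hN1 k S', if_pos (hS'.1.trans hk.symm)]
  have hne : U.weightSpace F Θ' S' (k + 1) ≠ ⊥ := fun h => by rw [h, finrank_bot] at hfin; exact zero_ne_one hfin
  obtain ⟨y, hy, hy0⟩ := Submodule.exists_mem_ne_zero_of_ne_bot hne
  have hyw : U.IsWeightVector F Θ' S' (2 * p') (U.castC _ hk y) :=
    U.isWeightVector_castC F Θ' S' hk ((U.mem_weightSpace_iff F Θ' S' _ y).1 hy)
  refine ⟨U.castC _ hk y, fun h => hy0 ((LinearEquiv.map_eq_zero_iff _).mp h), hyw, ?_⟩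
  have hB : U.weightSpace F Θ' S' (2 * p') ≤ (U.hodgeClassesOf (U.cmProd F Θ') p').baseChange ℂ := by
    rw [pohlmannBasis_of_facts M hN1 hN2 hN3 hN4 F hGal m Θ' p']
    exact le_iSup₂_of_le S' hS' le_rfl
  exact Submodule.baseChange_mono ℂ (hHC p') (hB ((U.mem_weightSpace_iff F Θ' S' _ _).2 hyw))

end Universe

namespace Assembly

open Universe StubTree

variable (U : Universe)
/-- **Face reduction for a generating set of faces and known products, over the model facts** (`ModelAxioms` + N1–N4, F2, F4–F7;
pattern of b23's `Assembly.hc_cmProd_of_faceSet`, the known products entering as `U.HC (∏_j A_{(F,Θ′_j)})`, `Θ′ ∈ 𝒲`).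
[cite: Pohlmann1968, Thm. 1] [cite: Milne1999LefschetzClasses, Thm. 3.2 and Cor. 4.5] -/
theorem hc_cmProd_of_faceSet_of_hc (M : U.ModelAxioms)
    (hN1 : U.Fact_cupExterior) (hN2 : U.Fact_cup_hodge) (hN3 : U.Fact_pull_H0) (hN4 : U.Fact_hodge_F0)
    (h2 : U.Fact_factorActDescends) (h4 : U.Fact_cupAlg) (h5 : U.Fact_cupAssoc) (h6 : U.Fact_weightDual)
    (h7 : U.Fact_gysin) {F : CMField} (hGal : IsGalois ℚ F) (hdeg : 6 ≤ Module.finrank ℚ F)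
    (𝒮 : Set (Face F)) (𝒲 : Set ((m : ℕ) × (Fin (m + 1) → CMType F))) (hHC : ∀ w ∈ 𝒲, U.HC (U.cmProd F w.2))
    (σ₀ : (F : Type) →+* ℂ)
    (hgen : ∀ f : Face F, lefChar f.corner (fun _ => ({σ₀} : Finset ((F : Type) →+* ℂ))) ∈ AddSubgroup.closure
      {a : Asym F | (∃ g ∈ 𝒮, ∃ σ : (F : Type) →+* ℂ,
          a = lefChar g.corner (fun _ => ({σ} : Finset ((F : Type) →+* ℂ)))) ∨
        ∃ w ∈ 𝒲, ∃ (p' : ℕ) (S' : Fin (w.1 + 1) → Finset ((F : Type) →+* ℂ)),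
          IsHodgeWeight w.2 p' S' ∧ a = lefChar w.2 S'})
    (hWeil : ∀ f ∈ 𝒮, U.WeilFaceAlgebraic F f) {n : ℕ} (Θ : Fin (n + 1) → CMType F) : U.HC (U.cmProd F Θ) :=
  Universe.hc_cmProd_of_faceSet_of_known (U.pohlmannSpan_of_facts M hN1 hN2 hN3 hN4) U.qw8Conj_holds
    (U.qw8ExtProd_of_facts M h2 h4 h5 h6 h7) (U.qw8DualPushPull_of_facts M h2 h4 h5 h6 h7)
    (qw8Milne_of_facts M hN1 hN2 hN3 hN4 h2 h4 h5 h6 h7) (qw8FaceBridge_holds M) hGal hdeg 𝒮 𝒲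
    (fun w hw _ _ hp' hS' => Universe.exists_weightVector_mem_algC_of_hc M hN1 hN2 hN3 hN4 hGal (hHC w hw) hp' hS')
    σ₀ hgen hWeil Θ

end Assembly

/-! ## §3 The model universe `Model.universeOf hHD hI hU h₃`, modulo Riemann's theorem -/

namespace Model

open Summit.HodgeConjecture.CorCM.Domination
/-- **`U.HC` of the model's `∏_j A_{(F,Θ_j)}` is `HodgeConjectureFor` of the tree's abelian variety `Domination.cmProdAV F h₃ n Θ`**
(`scheme_cmProd_universeOf`, `schemeDim_eq_holds`, `universeOf_hc_iff_hodgeConjectureFor`; both directions of the reading used by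
b23's `Model.hodgeConjectureFor_cmProdAV_of_faceSet`) — so known products are fed, and conclusions read, on the tree's abelian
varieties. [cite: Milne2020HodgeClassesAV, Theorem 1] -/
theorem universeOf_hc_cmProd_iff_hodgeConjectureFor_cmProdAV
    (hHD : exists_isReal_hodgeModel) (hI : hodgePQ_independent_of_hodgeModel) (hU : BallQuotientUniformisedDatum)
    (h₃ : CMAbelianVarietyRealised) {F : CMField} {n : ℕ} (Θ : Fin (n + 1) → CMType F) :
    (universeOf hHD hI hU h₃).HC ((universeOf hHD hI hU h₃).cmProd F Θ) ↔
      HodgeConjectureFor (cmProdAV F h₃ n Θ).dim (cmProdAV F h₃ n Θ).X := by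
  have hX : PicardCM.Var.scheme hU h₃ ((universeOf hHD hI hU h₃).cmProd F Θ) = (cmProdAV F h₃ n Θ).X :=
    scheme_cmProd_universeOf hHD hI hU h₃ F n Θ
  have hdim : (cmProdAV F h₃ n Θ).dim = (universeOf hHD hI hU h₃).dim ((universeOf hHD hI hU h₃).cmProd F Θ) := by
    rw [AbelianVariety.dim, ← hX]
    exact schemeDim_eq_holds (PicardCM.Var.isSmoothProjective hU h₃ _)
  rw [hdim, ← hX]
  exact universeOf_hc_iff_hodgeConjectureFor hHD hI hU h₃ _

/-- **Face reduction for a generating set of faces and known products, on the model** (rows fed exactly as in b23's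
`Model.universeOf_hc_cmProd_of_faceSet`; the known products enter as `HodgeConjectureFor` of the tree's `∏_j A_{(F,Θ′_j)}`), modulo
Riemann's theorem `hR`. [cite: Pohlmann1968, Thm. 1] [cite: Milne1999LefschetzClasses, Thm. 3.2 and Cor. 4.5]
[cite: DeligneMilne1982Tannakian, §6 Thm. 6.20 (Riemann), p. 212] -/
theorem universeOf_hc_cmProd_of_faceSet_of_hodgeConjectureFor
    (hHD : exists_isReal_hodgeModel) (hI : hodgePQ_independent_of_hodgeModel) (hU : BallQuotientUniformisedDatum)
    (h₃ : CMAbelianVarietyRealised) (hR : DeligneMilne1982_Thm_6_20_full) {F : CMField} (hGal : IsGalois ℚ F)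
    (h6 : 6 ≤ Module.finrank ℚ F) (𝒮 : Set (Face F)) (𝒲 : Set ((m : ℕ) × (Fin (m + 1) → CMType F)))
    (hHC : ∀ w ∈ 𝒲, HodgeConjectureFor (cmProdAV F h₃ w.1 w.2).dim (cmProdAV F h₃ w.1 w.2).X)
    (σ₀ : (F : Type) →+* ℂ)
    (hgen : ∀ f : Face F, lefChar f.corner (fun _ => ({σ₀} : Finset ((F : Type) →+* ℂ))) ∈ AddSubgroup.closure
      {a : Asym F | (∃ g ∈ 𝒮, ∃ σ : (F : Type) →+* ℂ,
          a = lefChar g.corner (fun _ => ({σ} : Finset ((F : Type) →+* ℂ)))) ∨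
        ∃ w ∈ 𝒲, ∃ (p' : ℕ) (S' : Fin (w.1 + 1) → Finset ((F : Type) →+* ℂ)),
          IsHodgeWeight w.2 p' S' ∧ a = lefChar w.2 S'})
    (hWeil : ∀ f ∈ 𝒮, (universeOf hHD hI hU h₃).WeilFaceAlgebraic F f)
    {n : ℕ} (Θ : Fin (n + 1) → CMType F) :
    (universeOf hHD hI hU h₃).HC ((universeOf hHD hI hU h₃).cmProd F Θ) :=
  Assembly.hc_cmProd_of_faceSet_of_hc (universeOf hHD hI hU h₃)
    (modelAxioms_of_rows hHD hI hU h₃ hR (universeOf_algDuality hHD hI hU h₃))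
    (universeOf_fact_cupExterior hHD hI hU h₃) (universeOf_fact_cup_hodge hHD hI hU h₃)
    (universeOf_fact_pull_H0 hHD hI hU h₃) (universeOf_fact_hodge_F0 hHD hI hU h₃)
    (universeOf_fact_factorActDescends hHD hI hU h₃
      (modelAxioms_of_rows hHD hI hU h₃ hR (universeOf_algDuality hHD hI hU h₃)))
    (universeOf_fact_cupAlg hHD hI hU h₃) (universeOf_fact_cupAssoc hHD hI hU h₃)
    (universeOf_fact_weightDual hHD hI hU h₃
      (modelAxioms_of_rows hHD hI hU h₃ hR (universeOf_algDuality hHD hI hU h₃)))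
    (universeOf_fact_gysin hHD hI hU h₃) hGal h6 𝒮 𝒲
    (fun w hw => (universeOf_hc_cmProd_iff_hodgeConjectureFor_cmProdAV hHD hI hU h₃ w.2).2 (hHC w hw)) σ₀ hgen hWeil Θ

/-- **On the tree's abelian variety `∏_j A_{(F,Θ_j)}`**: the Hodge conjecture in every codimension, from the Weil lines of the
faces of `𝒮` and the Hodge conjecture of the products of `𝒲`, modulo `hR` and the model data.
[cite: Pohlmann1968, Thm. 1] [cite: Milne2020HodgeClassesAV, Theorem 1] -/
theorem hodgeConjectureFor_cmProdAV_of_faceSet_of_hodgeConjectureFor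
    (hHD : exists_isReal_hodgeModel) (hI : hodgePQ_independent_of_hodgeModel) (hU : BallQuotientUniformisedDatum)
    (h₃ : CMAbelianVarietyRealised) (hR : DeligneMilne1982_Thm_6_20_full) {F : CMField} (hGal : IsGalois ℚ F)
    (h6 : 6 ≤ Module.finrank ℚ F) (𝒮 : Set (Face F)) (𝒲 : Set ((m : ℕ) × (Fin (m + 1) → CMType F)))
    (hHC : ∀ w ∈ 𝒲, HodgeConjectureFor (cmProdAV F h₃ w.1 w.2).dim (cmProdAV F h₃ w.1 w.2).X)
    (σ₀ : (F : Type) →+* ℂ)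
    (hgen : ∀ f : Face F, lefChar f.corner (fun _ => ({σ₀} : Finset ((F : Type) →+* ℂ))) ∈ AddSubgroup.closure
      {a : Asym F | (∃ g ∈ 𝒮, ∃ σ : (F : Type) →+* ℂ,
          a = lefChar g.corner (fun _ => ({σ} : Finset ((F : Type) →+* ℂ)))) ∨
        ∃ w ∈ 𝒲, ∃ (p' : ℕ) (S' : Fin (w.1 + 1) → Finset ((F : Type) →+* ℂ)),
          IsHodgeWeight w.2 p' S' ∧ a = lefChar w.2 S'})
    (hWeil : ∀ f ∈ 𝒮, (universeOf hHD hI hU h₃).WeilFaceAlgebraic F f)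
    {n : ℕ} (Θ : Fin (n + 1) → CMType F) :
    HodgeConjectureFor (cmProdAV F h₃ n Θ).dim (cmProdAV F h₃ n Θ).X :=
  (universeOf_hc_cmProd_iff_hodgeConjectureFor_cmProdAV hHD hI hU h₃ Θ).1
    (universeOf_hc_cmProd_of_faceSet_of_hodgeConjectureFor hHD hI hU h₃ hR hGal h6 𝒮 𝒲 hHC σ₀ hgen hWeil Θ)

/-- **The `F`-generated CM slice from a generating set of faces and known products, on the model**: every complex abelian variety
dominated by a finite product of realisations of CM types of CM fields `E →+* F` satisfies the Hodge conjecture in every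
codimension, from the Weil lines of the faces of `𝒮` and the Hodge conjecture of the products of `𝒲` — modulo `hR` (domination
calculus of `CorCM/Model/CMSliceOfWeilFaces.lean`). [cite: Shimura1998, §6.2 Theorem 3 and §6.1 Corollary of Theorem 2 (pp. 41–43)]
[cite: MumfordAV1970, §19 Thm. 1 and p. 169] -/
theorem hodgeConjectureFor_of_avDominatedBy_isProductOf_of_faceSet_of_hodgeConjectureFor
    (hHD : exists_isReal_hodgeModel) (hI : hodgePQ_independent_of_hodgeModel) (hU : BallQuotientUniformisedDatum)
    (h₃ : CMAbelianVarietyRealised) (hR : DeligneMilne1982_Thm_6_20_full) {F : CMField} (hGal : IsGalois ℚ F)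
    (h6 : 6 ≤ Module.finrank ℚ F) (𝒮 : Set (Face F)) (𝒲 : Set ((m : ℕ) × (Fin (m + 1) → CMType F)))
    (hHC : ∀ w ∈ 𝒲, HodgeConjectureFor (cmProdAV F h₃ w.1 w.2).dim (cmProdAV F h₃ w.1 w.2).X)
    (σ₀ : (F : Type) →+* ℂ)
    (hgen : ∀ f : Face F, lefChar f.corner (fun _ => ({σ₀} : Finset ((F : Type) →+* ℂ))) ∈ AddSubgroup.closure
      {a : Asym F | (∃ g ∈ 𝒮, ∃ σ : (F : Type) →+* ℂ,
          a = lefChar g.corner (fun _ => ({σ} : Finset ((F : Type) →+* ℂ)))) ∨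
        ∃ w ∈ 𝒲, ∃ (p' : ℕ) (S' : Fin (w.1 + 1) → Finset ((F : Type) →+* ℂ)),
          IsHodgeWeight w.2 p' S' ∧ a = lefChar w.2 S'})
    (hWeil : ∀ f ∈ 𝒮, (universeOf hHD hI hU h₃).WeilFaceAlgebraic F f)
    {P A : AbelianVariety ℂ} (hP : AbelianVariety.IsProductOf (fun B : AbelianVariety ℂ =>
      ∃ (E : Type) (_ : Field E) (_ : NumberField E) (_ : IsCMField E) (_ : E →+* (F : Type)) (Φ : CMType E)
        (ι : 𝓞 E →+* End B) (θ : E →+* Module.End ℂ (complexBetti B.X 1)),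
        IsCMTypeRealisation Φ B ι θ) P)
    (hA : AVDominatedBy A P) : HodgeConjectureFor A.dim A.X := by
  obtain ⟨n, Θ, h⟩ := exists_avDominatedBy_cmProdAV_of_isProductOf_realisations h₃
    (thm3_isogenousPower_of_riemann hR h₃) (thm2_cor_of_riemann hR) hP
  exact hodgeConjectureFor_of_avDominatedBy
    (hodgeConjectureFor_cmProdAV_of_faceSet_of_hodgeConjectureFor hHD hI hU h₃ hR hGal h6 𝒮 𝒲 hHC σ₀ hgen hWeil Θ) (hA.trans h)

end Model

/-! ## §4 CLOSED forms on the universe of record (model data = tree theorems) -/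

open Summit.HodgeConjecture.CorCM.Domination
/-- **INT-2 FOR A GENERATING SET OF FACES AND KNOWN PRODUCTS, CLOSED — Weil-line form.**  For ONE Galois CM field `K` with
`6 ≤ [K:ℚ]`, `σ₀`, a set `𝒮` of faces and a set `𝒲` of finite families of CM types of `K` with the enlarged generation binder: if
the Weil lines `W_K(P(f))`, `f ∈ 𝒮`, are algebraic on the universe of record and the tree's products `∏_j A_{(K,Θ′_j)}`, `Θ′ ∈ 𝒲`
(`Domination.cmProdAV K cmAbelianVarietyRealised_holds`), satisfy the Hodge conjecture, then so does, in every codimension, every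
complex abelian variety dominated by a finite product of realisations of CM types of CM fields embeddable in `K`.
[cite: Shimura1998, §6.2 Theorem 3 and §6.1 Corollary of Theorem 2 (pp. 41–43)] [cite: Pohlmann1968, Thm. 1]
[cite: Milne1999LefschetzClasses, Thm. 3.2 and Cor. 4.5] [cite: MumfordAV1970, §19 Thm. 1 and p. 169] -/
theorem hodgeConjectureFor_of_avDominatedBy_isProductOf_of_weilFaceAlgebraic_of_hodgeConjectureFor_on (K : CMField)
    [hGal : IsGalois ℚ K] (h6 : 6 ≤ Module.finrank ℚ K) (𝒮 : Set (Face K))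
    (𝒲 : Set ((m : ℕ) × (Fin (m + 1) → CMType K)))
    (hHC : ∀ w ∈ 𝒲, HodgeConjectureFor (cmProdAV K cmAbelianVarietyRealised_holds w.1 w.2).dim
      (cmProdAV K cmAbelianVarietyRealised_holds w.1 w.2).X)
    (σ₀ : (K : Type) →+* ℂ)
    (hgen : ∀ f : Face K, lefChar f.corner (fun _ => ({σ₀} : Finset ((K : Type) →+* ℂ))) ∈ AddSubgroup.closure
      {a : Asym K | (∃ g ∈ 𝒮, ∃ σ : (K : Type) →+* ℂ,
          a = lefChar g.corner (fun _ => ({σ} : Finset ((K : Type) →+* ℂ)))) ∨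
        ∃ w ∈ 𝒲, ∃ (p' : ℕ) (S' : Fin (w.1 + 1) → Finset ((K : Type) →+* ℂ)),
          IsHodgeWeight w.2 p' S' ∧ a = lefChar w.2 S'})
    (hWeil : ∀ f ∈ 𝒮, (Model.picardCMUniverse exists_isReal_hodgeModel_holds hodgePQ_independent_of_hodgeModel_holds
      BallQuotient.ballQuotientUniformised_holds cmAbelianVarietyRealised_holds).WeilFaceAlgebraic K f)
    {P A : AbelianVariety ℂ} (hP : AbelianVariety.IsProductOf (fun B : AbelianVariety ℂ =>
      ∃ (E : Type) (_ : Field E) (_ : NumberField E) (_ : IsCMField E) (_ : E →+* (K : Type)) (Φ : CMType E)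
        (ι : 𝓞 E →+* End B) (θ : E →+* Module.End ℂ (complexBetti B.X 1)),
        IsCMTypeRealisation Φ B ι θ) P)
    (hA : AVDominatedBy A P) : HodgeConjectureFor A.dim A.X :=
  Model.hodgeConjectureFor_of_avDominatedBy_isProductOf_of_faceSet_of_hodgeConjectureFor _ _ _ _
    deligneMilne1982_Thm_6_20_full_holds hGal h6 𝒮 𝒲 hHC σ₀ hgen hWeil hP hA

/-- **INT-2 FOR A GENERATING SET OF FACES AND KNOWN PRODUCTS, CLOSED — period-witness form (headline).**  For ONE Galois CM field
`K` with `6 ≤ [K:ℚ]`, `σ₀`, a set `𝒮` of faces and a set `𝒲` of finite families of CM types of `K` such that the `σ₀`-Weil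
character of every face of `K` lies in the subgroup generated by the Weil characters of `𝒮` (all `σ`) and the Lefschetz characters
of the Hodge weights of `𝒲`: ONE period witness per face OF `𝒮` on the universe of record together with the Hodge conjecture for
the tree's products `∏_j A_{(K,Θ′_j)}`, `Θ′ ∈ 𝒲`, implies the Hodge conjecture, in every codimension, for every complex abelian
variety dominated by a finite product of abelian varieties each realising a CM type of a CM field `E →+* K`.  NO other hypothesis.
(FRAMING: a statement about ONE field `K`, conditional on the face periods of `𝒮`, on `HodgeConjectureFor` of the products of `𝒲`
and on `hgen`; `HC_CM` is not proved.) [cite: Shimura1998, §6.2 Theorem 3 and §6.1 Corollary of Theorem 2 (pp. 41–43)]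
[cite: Pohlmann1968, Thm. 1] [cite: Milne1999LefschetzClasses, Thm. 3.2 and Cor. 4.5] [cite: MumfordAV1970, §19 Thm. 1 and p. 169] -/
theorem hodgeConjectureFor_of_avDominatedBy_isProductOf_of_exists_facePeriod_of_hodgeConjectureFor_on (K : CMField)
    [hGal : IsGalois ℚ K] (h6 : 6 ≤ Module.finrank ℚ K) (𝒮 : Set (Face K))
    (𝒲 : Set ((m : ℕ) × (Fin (m + 1) → CMType K)))
    (hHC : ∀ w ∈ 𝒲, HodgeConjectureFor (cmProdAV K cmAbelianVarietyRealised_holds w.1 w.2).dim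
      (cmProdAV K cmAbelianVarietyRealised_holds w.1 w.2).X)
    (σ₀ : (K : Type) →+* ℂ)
    (hgen : ∀ f : Face K, lefChar f.corner (fun _ => ({σ₀} : Finset ((K : Type) →+* ℂ))) ∈ AddSubgroup.closure
      {a : Asym K | (∃ g ∈ 𝒮, ∃ σ : (K : Type) →+* ℂ,
          a = lefChar g.corner (fun _ => ({σ} : Finset ((K : Type) →+* ℂ)))) ∨
        ∃ w ∈ 𝒲, ∃ (p' : ℕ) (S' : Fin (w.1 + 1) → Finset ((K : Type) →+* ℂ)),
          IsHodgeWeight w.2 p' S' ∧ a = lefChar w.2 S'})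
    (h : ∀ f ∈ 𝒮, ∃ ι₁ : K →+* ℂ, f.Admissible ι₁ ∧ ∃ (V : HermSpace3 K ι₁) (σ : K →+* ℂ),
      (Model.picardCMUniverse exists_isReal_hodgeModel_holds hodgePQ_independent_of_hodgeModel_holds
        BallQuotient.ballQuotientUniformised_holds cmAbelianVarietyRealised_holds).PeriodNV ι₁ V K f.psi σ)
    {P A : AbelianVariety ℂ} (hP : AbelianVariety.IsProductOf (fun B : AbelianVariety ℂ =>
      ∃ (E : Type) (_ : Field E) (_ : NumberField E) (_ : IsCMField E) (_ : E →+* (K : Type)) (Φ : CMType E)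
        (ι : 𝓞 E →+* End B) (θ : E →+* Module.End ℂ (complexBetti B.X 1)),
        IsCMTypeRealisation Φ B ι θ) P)
    (hA : AVDominatedBy A P) : HodgeConjectureFor A.dim A.X :=
  hodgeConjectureFor_of_avDominatedBy_isProductOf_of_weilFaceAlgebraic_of_hodgeConjectureFor_on K h6 𝒮 𝒲 hHC σ₀ hgen
    (fun f hf => weilFaceAlgebraic_of_exists_facePeriod hGal f (h f hf)) hP hA

end Summit.HodgeConjecture.CorCM
end
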